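import Mathlib

/-!
# `BalabanUV.Beta.GAN24.SaddlePointBound` — binder row G-an2-4 / (CONV-C), road P1-fibre, leaf **P1-L10a** of
# `HOME/LEMMAS.md` § GAN24 SKELETON-P1 LEAF CLAIM TABLE: the finite-dimensional BREZZI / LBB saddle-point bound (PART 1: a priori
# estimate, bijectivity, invertibility of `Matrix.fromBlocks H C B 0`; PART 2 `SaddlePointBoundInverse` = bounds on the inverse)

NOT IN PRINT; OUR PROOF (of a textbook statement).  HONEST FRAMING (cell contract, verbatim): «discharging `BetaPertH` makes Bałaban's UV
stability UNCONDITIONAL — a real constructive-QFT result; it is NOT the continuum limit and NOT the Clay problem.»  HONEST DEPENDENCY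
(verbatim): «continuum YM on T⁴ ⇐ BetaPertH ∧ nine spine estimates (0/9 proved); BetaPertH ⇐ (D1) ∧ (D4) ∧ CAP+tail; G-an2-4 gates asym,
D1 and NE2/3/4.»  [folklore] finite-dimensional linear algebra over an `RCLike` field `𝕜` (the consumer takes `𝕜 = ℂ`); no cited fact, no
`def`, no wall binder, nothing of (CONV-C)'s K-slot discharged.  NOT summit progress.

## What is proved (the abstract engine named in the table row; statement shape: Brezzi 1974; S. Bartels, *Numerical Approximation of
## PDEs* (Springer 2016) Thm 6.4 p. 202 with Lemma 6.5 p. 201; the two-kernel form is the Nicolaides / Bernardi–Canuto–Maday generalisation)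
Data: finite-dimensional inner-product spaces `V`, `Q` over `𝕜`, linear maps `H : V → V`, `B : V → Q` (constraint rows), `C : Q → V`
(multiplier columns; the classical case is `C = B†`), and the block operator `(u, p) ↦ (H u + C p, B u)` on `V × Q`, i.e. the matrix
`K = [[H, C], [B, 0]]`.  Hypotheses (all constants explicit, nothing else enters):
* `hB`  — LBB / inf-sup for the constraint: `β₁‖q‖ ≤ ‖B† q‖` for all `q` (§1 turns it into `β₁‖x‖ ≤ ‖B x‖` on `(ker B)ᗮ`);
* `hC`  — injectivity of the multiplier columns with constant: `β₂‖q‖ ≤ ‖C q‖` (for `C = B†` this IS `hB`);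
* `hHC` — kernel inf-sup of `H` between `ker B` and `(range C)ᗮ = ker C†`: every `w ∈ ker B` has a test vector `z ⊥ range C` with
  `‖z‖ ≤ ‖w‖` and `γ‖w‖² ≤ re ⟪z, H w⟫` (for `C = B†` take `z = w`: this is COERCIVITY OF `re ⟪w, H w⟫` ON `ker B`, `test_vector_of_coercive`;
  `H` need NOT be Hermitian or positive — only this real-part lower bound on the kernel is used);
* `hH`  — `‖H v‖ ≤ η‖v‖`, `0 ≤ η`.
Conclusions: `apriori` — for EVERY `(u, p)`, with `f := H u + C p`, `g := B u`:
  `‖u‖ ≤ γ⁻¹‖f‖ + β₁⁻¹(1 + η/γ)‖g‖`,  `‖p‖ ≤ β₂⁻¹(1 + η/γ)‖f‖ + β₂⁻¹β₁⁻¹η(1 + η/γ)‖g‖`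
(the classical Brezzi constants); `bijective` — the block operator is a linear bijection of `V × Q`; `apriori_adjoint`, `bijective_adjoint` —
the case `C = B†`; §5 `matrix_apriori`, `isUnit_fromBlocks` (+ `_conjTranspose` versions) — the same for `K = Matrix.fromBlocks H C B 0 :
Matrix (n ⊕ m) (n ⊕ m) 𝕜` with Euclidean norms (`EuclideanSpace 𝕜 n`, hypotheses through `Matrix.toEuclideanLin`).
Proof = the standard splitting `u = P_{ker B} u + (u − P_{ker B} u)` with the orthogonal projection (`Submodule.starProjection`), the test
vector of `hHC` against `f`, and `C p = f − H u`; injective ⇒ surjective in finite dimensions.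

## Why the two-kernel form (remark for leaves P1-L09 / P1-L10; nothing below is used or asserted in this file)
After a Combes–Thomas conjugation `K ↦ W K W⁻¹` by a positive diagonal weight the column block `W_V C W_Q⁻¹` is no longer the adjoint of the
row block `W_Q B W_V⁻¹`, but the hypotheses above are conjugation-stable: `ker (W_Q B W_V⁻¹) = W_V ker B`, `(range (W_V C W_Q⁻¹))ᗮ =
W_V⁻¹ (range C)ᗮ`, and for `w = W_V a`, `z = W_V⁻¹ a` one has `⟪z, W_V H W_V⁻¹ w⟫ = ⟪a, H a⟫`; so the real-zone constants transfer to the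
strip up to the condition numbers of the weights.  The constants depend on `‖H‖/γ` (the condition number of `H` on the kernel): making
that ratio `N`-uniform in the fibre application is the business of the consuming leaves (units / decimated legs), not of this file.
-/

open scoped InnerProductSpace
open RCLike

namespace Summit.QuantumFields.BalabanUV.Beta.GAN24.SaddlePointBound

variable {𝕜 : Type*} [RCLike 𝕜]
variable {V Q : Type*} [NormedAddCommGroup V] [InnerProductSpace 𝕜 V] [FiniteDimensional 𝕜 V]
  [NormedAddCommGroup Q] [InnerProductSpace 𝕜 Q] [FiniteDimensional 𝕜 Q]

/-! ## §1 From the inf-sup (LBB) condition to a lower bound on the orthogonal complement of the kernel -/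

/-- [folklore] In finite dimensions `(ker B)ᗮ ⊆ range B†`. -/
theorem ker_orthogonal_le_range_adjoint (B : V →ₗ[𝕜] Q) :
    (LinearMap.ker B)ᗮ ≤ LinearMap.range (LinearMap.adjoint B) := by
  have h : (LinearMap.range (LinearMap.adjoint B))ᗮ ≤ LinearMap.ker B := by
    intro y hy
    rw [Submodule.mem_orthogonal] at hy
    have h1 : ⟪LinearMap.adjoint B (B y), y⟫_𝕜 = 0 := hy _ (LinearMap.mem_range_self _ _)
    rw [LinearMap.adjoint_inner_left] at h1
    exact LinearMap.mem_ker.mpr (inner_self_eq_zero.mp h1)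
  calc (LinearMap.ker B)ᗮ ≤ (LinearMap.range (LinearMap.adjoint B))ᗮᗮ := Submodule.orthogonal_le h
    _ = LinearMap.range (LinearMap.adjoint B) := Submodule.orthogonal_orthogonal _

/-- [folklore] The inf-sup (LBB) condition `β‖q‖ ≤ ‖B† q‖` implies that `B` is bounded below by `β` on `(ker B)ᗮ`
(Bartels 2016, Lemma 6.5 (iii) ⇒ (ii), finite-dimensional case). -/
theorem norm_le_of_mem_ker_orthogonal (B : V →ₗ[𝕜] Q) {β : ℝ}
    (hB : ∀ q : Q, β * ‖q‖ ≤ ‖LinearMap.adjoint B q‖) {x : V} (hx : x ∈ (LinearMap.ker B)ᗮ) :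
    β * ‖x‖ ≤ ‖B x‖ := by
  obtain ⟨q, rfl⟩ := ker_orthogonal_le_range_adjoint B hx
  set x := LinearMap.adjoint B q with hxq
  by_cases hb : 0 ≤ β
  swap
  · exact (mul_nonpos_of_nonpos_of_nonneg (lt_of_not_ge hb).le (norm_nonneg _)).trans (norm_nonneg _)
  by_cases hx0 : x = 0
  · rw [hx0, norm_zero, mul_zero]; exact norm_nonneg _
  · have hxpos : 0 < ‖x‖ := norm_pos_iff.mpr hx0
    have h1 : ‖x‖ ^ 2 = re ⟪q, B x⟫_𝕜 := by
      rw [← LinearMap.adjoint_inner_left, ← hxq, inner_self_eq_norm_sq]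
    have h2 : ‖x‖ ^ 2 ≤ ‖q‖ * ‖B x‖ := h1 ▸ re_inner_le_norm q (B x)
    have h3 : β * ‖q‖ ≤ ‖x‖ := hB q
    have h4 : (β * ‖x‖) * ‖x‖ ≤ ‖B x‖ * ‖x‖ := by
      calc (β * ‖x‖) * ‖x‖ = β * ‖x‖ ^ 2 := by ring
        _ ≤ β * (‖q‖ * ‖B x‖) := mul_le_mul_of_nonneg_left h2 hb
        _ = (β * ‖q‖) * ‖B x‖ := by ring
        _ ≤ ‖x‖ * ‖B x‖ := mul_le_mul_of_nonneg_right h3 (norm_nonneg _)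
        _ = ‖B x‖ * ‖x‖ := by ring
    exact le_of_mul_le_mul_right h4 hxpos

/-! ## §2 The a priori estimate (generalized saddle point: independent column block `C`) -/

omit [FiniteDimensional 𝕜 Q] in
/-- [folklore] **A priori (stability) estimate for the generalized saddle-point operator**
`(u, p) ↦ (H u + C p, B u)` on `V × Q`. -/
theorem apriori {H : V →ₗ[𝕜] V} {B : V →ₗ[𝕜] Q} {C : Q →ₗ[𝕜] V} {γ β₁ β₂ η : ℝ}
    (hγ : 0 < γ) (hβ₁ : 0 < β₁) (hβ₂ : 0 < β₂) (hη : 0 ≤ η)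
    (hB : ∀ x ∈ (LinearMap.ker B)ᗮ, β₁ * ‖x‖ ≤ ‖B x‖)
    (hC : ∀ q : Q, β₂ * ‖q‖ ≤ ‖C q‖)
    (hHC : ∀ w ∈ LinearMap.ker B, ∃ z : V,
      (∀ q : Q, ⟪z, C q⟫_𝕜 = 0) ∧ ‖z‖ ≤ ‖w‖ ∧ γ * ‖w‖ ^ 2 ≤ re ⟪z, H w⟫_𝕜)
    (hH : ∀ v : V, ‖H v‖ ≤ η * ‖v‖) (u : V) (p : Q) :
    ‖u‖ ≤ γ⁻¹ * ‖H u + C p‖ + β₁⁻¹ * (1 + η / γ) * ‖B u‖ ∧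
      ‖p‖ ≤ β₂⁻¹ * (1 + η / γ) * ‖H u + C p‖ + β₂⁻¹ * β₁⁻¹ * η * (1 + η / γ) * ‖B u‖ := by
  set f := H u + C p with hf
  set g := B u with hg
  set K := LinearMap.ker B with hK
  set w := K.starProjection u with hw
  set x := u - w with hxdef
  have hwK : w ∈ K := K.starProjection_apply_mem u
  have hxK : x ∈ Kᗮ := Submodule.sub_starProjection_mem_orthogonal (K := K) u
  have hBw : B w = 0 := LinearMap.mem_ker.mp hwK
  have hux : u = w + x := by rw [hxdef]; abel
  have hBx : B x = g := by rw [hxdef, map_sub, hBw, sub_zero]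
  -- Step 1: the component orthogonal to the kernel is controlled by `g = B u`.
  have hx_le : ‖x‖ ≤ β₁⁻¹ * ‖g‖ := by
    have h1 := hB x hxK
    rw [hBx] at h1
    rw [inv_mul_eq_div, le_div_iff₀ hβ₁]
    linarith
  -- Step 2: the kernel component is controlled through the test vector `z`.
  obtain ⟨z, hzC, hzw, hzH⟩ := hHC w hwK
  have hHux : H u = H w + H x := by rw [hux, map_add]
  have key : ⟪z, H w⟫_𝕜 = ⟪z, f⟫_𝕜 - ⟪z, H x⟫_𝕜 := by
    rw [hf, hHux, inner_add_right, inner_add_right, hzC p]; ring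
  have hw_le : ‖w‖ ≤ γ⁻¹ * (‖f‖ + η * (β₁⁻¹ * ‖g‖)) := by
    have h1 : γ * ‖w‖ ^ 2 ≤ ‖w‖ * (‖f‖ + η * (β₁⁻¹ * ‖g‖)) := by
      have a1 := re_inner_le_norm (𝕜 := 𝕜) z f
      have a2 : -(re ⟪z, H x⟫_𝕜) ≤ ‖z‖ * ‖H x‖ := by
        have := re_inner_le_norm (𝕜 := 𝕜) z (-(H x))
        rwa [inner_neg_right, map_neg, norm_neg] at this
      have a3 : ‖H x‖ ≤ η * (β₁⁻¹ * ‖g‖) := (hH x).trans (mul_le_mul_of_nonneg_left hx_le hη)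
      calc γ * ‖w‖ ^ 2 ≤ re ⟪z, H w⟫_𝕜 := hzH
        _ = re ⟪z, f⟫_𝕜 - re ⟪z, H x⟫_𝕜 := by rw [key, map_sub]
        _ ≤ ‖z‖ * ‖f‖ + ‖z‖ * ‖H x‖ := by linarith
        _ ≤ ‖w‖ * ‖f‖ + ‖w‖ * (η * (β₁⁻¹ * ‖g‖)) := by gcongr
        _ = ‖w‖ * (‖f‖ + η * (β₁⁻¹ * ‖g‖)) := by ring
    by_cases hw0 : ‖w‖ = 0
    · rw [hw0]; positivity
    · have hwpos : 0 < ‖w‖ := (norm_nonneg w).lt_of_ne (Ne.symm hw0)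
      have h2 : (γ * ‖w‖) * ‖w‖ ≤ (‖f‖ + η * (β₁⁻¹ * ‖g‖)) * ‖w‖ := by
        calc (γ * ‖w‖) * ‖w‖ = γ * ‖w‖ ^ 2 := by ring
          _ ≤ ‖w‖ * (‖f‖ + η * (β₁⁻¹ * ‖g‖)) := h1
          _ = (‖f‖ + η * (β₁⁻¹ * ‖g‖)) * ‖w‖ := by ring
      have h3 : γ * ‖w‖ ≤ ‖f‖ + η * (β₁⁻¹ * ‖g‖) := le_of_mul_le_mul_right h2 hwpos
      rw [inv_mul_eq_div, le_div_iff₀' hγ]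
      exact h3
  -- Step 3: `u = w + x`.
  have hu : ‖u‖ ≤ γ⁻¹ * ‖f‖ + β₁⁻¹ * (1 + η / γ) * ‖g‖ := by
    calc ‖u‖ = ‖w + x‖ := by rw [← hux]
      _ ≤ ‖w‖ + ‖x‖ := norm_add_le w x
      _ ≤ γ⁻¹ * (‖f‖ + η * (β₁⁻¹ * ‖g‖)) + β₁⁻¹ * ‖g‖ := add_le_add hw_le hx_le
      _ = γ⁻¹ * ‖f‖ + β₁⁻¹ * (1 + η / γ) * ‖g‖ := by
          rw [div_eq_mul_inv]; ring
  refine ⟨hu, ?_⟩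
  -- Step 4: the multiplier from `C p = f - H u`.
  have hCp : C p = f - H u := by rw [hf]; abel
  have hp1 : β₂ * ‖p‖ ≤ ‖f‖ + η * ‖u‖ := by
    calc β₂ * ‖p‖ ≤ ‖C p‖ := hC p
      _ = ‖f - H u‖ := by rw [hCp]
      _ ≤ ‖f‖ + ‖H u‖ := norm_sub_le f (H u)
      _ ≤ ‖f‖ + η * ‖u‖ := by gcongr; exact hH u
  have hp2 : ‖p‖ ≤ β₂⁻¹ * (‖f‖ + η * ‖u‖) := by
    rw [inv_mul_eq_div, le_div_iff₀' hβ₂]; exact hp1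
  calc ‖p‖ ≤ β₂⁻¹ * (‖f‖ + η * ‖u‖) := hp2
    _ ≤ β₂⁻¹ * (‖f‖ + η * (γ⁻¹ * ‖f‖ + β₁⁻¹ * (1 + η / γ) * ‖g‖)) := by gcongr
    _ = β₂⁻¹ * (1 + η / γ) * ‖f‖ + β₂⁻¹ * β₁⁻¹ * η * (1 + η / γ) * ‖g‖ := by
        rw [div_eq_mul_inv]; ring

/-! ## §3 Invertibility of the block operator -/

/-- [folklore] Under the hypotheses of `apriori` the block operator `(u, p) ↦ (H u + C p, B u)` is a linear
bijection of `V × Q` (injective by the estimate, hence surjective in finite dimensions). -/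
theorem bijective {H : V →ₗ[𝕜] V} {B : V →ₗ[𝕜] Q} {C : Q →ₗ[𝕜] V} {γ β₁ β₂ η : ℝ}
    (hγ : 0 < γ) (hβ₁ : 0 < β₁) (hβ₂ : 0 < β₂) (hη : 0 ≤ η)
    (hB : ∀ x ∈ (LinearMap.ker B)ᗮ, β₁ * ‖x‖ ≤ ‖B x‖)
    (hC : ∀ q : Q, β₂ * ‖q‖ ≤ ‖C q‖)
    (hHC : ∀ w ∈ LinearMap.ker B, ∃ z : V,
      (∀ q : Q, ⟪z, C q⟫_𝕜 = 0) ∧ ‖z‖ ≤ ‖w‖ ∧ γ * ‖w‖ ^ 2 ≤ re ⟪z, H w⟫_𝕜)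
    (hH : ∀ v : V, ‖H v‖ ≤ η * ‖v‖) :
    Function.Bijective ((H.coprod C).prod (B.coprod (0 : Q →ₗ[𝕜] Q))) := by
  set L := (H.coprod C).prod (B.coprod (0 : Q →ₗ[𝕜] Q)) with hL
  have hinj : Function.Injective L := by
    rw [← LinearMap.ker_eq_bot, LinearMap.ker_eq_bot']
    rintro ⟨u, p⟩ h
    have h' : H u + C p = 0 ∧ B u = 0 := by
      simpa [hL, LinearMap.prod_apply, LinearMap.coprod_apply, Prod.mk_eq_zero] using h
    obtain ⟨h1, h2⟩ := h'
    have est := apriori hγ hβ₁ hβ₂ hη hB hC hHC hH u p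
    rw [h1, h2] at est
    have hu : u = 0 := by simpa using est.1
    have hp : p = 0 := by simpa using est.2
    rw [Prod.mk_eq_zero]; exact ⟨hu, hp⟩
  exact ⟨hinj, LinearMap.injective_iff_surjective.mp hinj⟩

/-! ## §4 The classical case `C = B†` (Brezzi): coercivity of `re ⟪·, H ·⟫` on `ker B` and the LBB condition for `B` -/

/-- [folklore] In the classical case the test vector is `z = w` itself: `⟪w, B† q⟫ = ⟪B w, q⟫ = 0` on `ker B`. -/
theorem test_vector_of_coercive {H : V →ₗ[𝕜] V} {B : V →ₗ[𝕜] Q} {γ : ℝ}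
    (hcoer : ∀ w ∈ LinearMap.ker B, γ * ‖w‖ ^ 2 ≤ re ⟪w, H w⟫_𝕜) :
    ∀ w ∈ LinearMap.ker B, ∃ z : V, (∀ q : Q, ⟪z, LinearMap.adjoint B q⟫_𝕜 = 0) ∧ ‖z‖ ≤ ‖w‖ ∧
      γ * ‖w‖ ^ 2 ≤ re ⟪z, H w⟫_𝕜 :=
  fun w hw => ⟨w, fun q => by
    rw [LinearMap.adjoint_inner_right, LinearMap.mem_ker.mp hw, inner_zero_left], le_rfl, hcoer w hw⟩

/-- [folklore] **Brezzi's a priori estimate** (Bartels 2016 Thm 6.4 shape, finite-dimensional, explicit constants): if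
`re ⟪w, H w⟫ ≥ γ‖w‖²` on `ker B`, `‖B† q‖ ≥ β‖q‖` and `‖H‖ ≤ η`, then every `(u, p)` obeys
`‖u‖ ≤ γ⁻¹‖H u + B† p‖ + β⁻¹(1 + η/γ)‖B u‖` and `‖p‖ ≤ β⁻¹(1 + η/γ)‖H u + B† p‖ + β⁻²η(1 + η/γ)‖B u‖`. -/
theorem apriori_adjoint {H : V →ₗ[𝕜] V} {B : V →ₗ[𝕜] Q} {γ β η : ℝ}
    (hγ : 0 < γ) (hβ : 0 < β) (hη : 0 ≤ η)
    (hB : ∀ q : Q, β * ‖q‖ ≤ ‖LinearMap.adjoint B q‖)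
    (hcoer : ∀ w ∈ LinearMap.ker B, γ * ‖w‖ ^ 2 ≤ re ⟪w, H w⟫_𝕜)
    (hH : ∀ v : V, ‖H v‖ ≤ η * ‖v‖) (u : V) (p : Q) :
    ‖u‖ ≤ γ⁻¹ * ‖H u + LinearMap.adjoint B p‖ + β⁻¹ * (1 + η / γ) * ‖B u‖ ∧
      ‖p‖ ≤ β⁻¹ * (1 + η / γ) * ‖H u + LinearMap.adjoint B p‖ +
        β⁻¹ * β⁻¹ * η * (1 + η / γ) * ‖B u‖ :=
  apriori hγ hβ hβ hη (fun _ hx => norm_le_of_mem_ker_orthogonal B hB hx) hB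
    (test_vector_of_coercive hcoer) hH u p

/-- [folklore] **Brezzi's splitting theorem, finite-dimensional**: under the hypotheses of `apriori_adjoint` the operator
`(u, p) ↦ (H u + B† p, B u)` is a linear bijection of `V × Q`. -/
theorem bijective_adjoint {H : V →ₗ[𝕜] V} {B : V →ₗ[𝕜] Q} {γ β η : ℝ}
    (hγ : 0 < γ) (hβ : 0 < β) (hη : 0 ≤ η)
    (hB : ∀ q : Q, β * ‖q‖ ≤ ‖LinearMap.adjoint B q‖)
    (hcoer : ∀ w ∈ LinearMap.ker B, γ * ‖w‖ ^ 2 ≤ re ⟪w, H w⟫_𝕜)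
    (hH : ∀ v : V, ‖H v‖ ≤ η * ‖v‖) :
    Function.Bijective
      ((H.coprod (LinearMap.adjoint B : Q →ₗ[𝕜] V)).prod (B.coprod (0 : Q →ₗ[𝕜] Q))) :=
  bijective hγ hβ hβ hη (fun _ hx => norm_le_of_mem_ker_orthogonal B hB hx) hB
    (test_vector_of_coercive hcoer) hH

/-! ## §5 Matrix form: `K = Matrix.fromBlocks H C B 0` over `𝕜`, Euclidean norms on `EuclideanSpace 𝕜 n`, `EuclideanSpace 𝕜 m` -/

section MatrixForm

open Matrix WithLp

variable {n m : Type*} [Fintype n] [DecidableEq n] [Fintype m] [DecidableEq m]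

omit [DecidableEq n] [DecidableEq m] in
/-- [folklore] Block action of `fromBlocks H C B 0` on `Sum.elim a b`. -/
theorem fromBlocks_mulVec_sumElim (H : Matrix n n 𝕜) (C : Matrix n m 𝕜) (B : Matrix m n 𝕜)
    (a : n → 𝕜) (b : m → 𝕜) :
    Matrix.fromBlocks H C B 0 *ᵥ Sum.elim a b = Sum.elim (H *ᵥ a + C *ᵥ b) (B *ᵥ a) := by
  rw [Matrix.fromBlocks_mulVec]; simp

/-- [folklore] **Matrix a priori estimate (generalized saddle point)**.  For `H : n × n`, `B : m × n`, `C : n × m` over `𝕜`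
with the LBB bound `β₁‖q‖ ≤ ‖Bᴴ q‖`, `β₂‖q‖ ≤ ‖C q‖`, the kernel inf-sup `∀ w ∈ ker B, ∃ z ∈ ker Cᴴ, ‖z‖ ≤ ‖w‖,
γ‖w‖² ≤ re ⟪z, H w⟫` and `‖H‖ ≤ η` (Euclidean norms), every pair `(a, b)` obeys the two Brezzi bounds in terms of
`H a + C b` and `B a`. -/
theorem matrix_apriori {H : Matrix n n 𝕜} {B : Matrix m n 𝕜} {C : Matrix n m 𝕜} {γ β₁ β₂ η : ℝ}
    (hγ : 0 < γ) (hβ₁ : 0 < β₁) (hβ₂ : 0 < β₂) (hη : 0 ≤ η)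
    (hB : ∀ q : EuclideanSpace 𝕜 m, β₁ * ‖q‖ ≤ ‖toEuclideanLin Bᴴ q‖)
    (hC : ∀ q : EuclideanSpace 𝕜 m, β₂ * ‖q‖ ≤ ‖toEuclideanLin C q‖)
    (hHC : ∀ w : EuclideanSpace 𝕜 n, toEuclideanLin B w = 0 → ∃ z : EuclideanSpace 𝕜 n,
      toEuclideanLin Cᴴ z = 0 ∧ ‖z‖ ≤ ‖w‖ ∧ γ * ‖w‖ ^ 2 ≤ re ⟪z, toEuclideanLin H w⟫_𝕜)
    (hH : ∀ v : EuclideanSpace 𝕜 n, ‖toEuclideanLin H v‖ ≤ η * ‖v‖)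
    (a : n → 𝕜) (b : m → 𝕜) :
    ‖(toLp 2 a : EuclideanSpace 𝕜 n)‖ ≤ γ⁻¹ * ‖(toLp 2 (H *ᵥ a + C *ᵥ b) : EuclideanSpace 𝕜 n)‖ +
        β₁⁻¹ * (1 + η / γ) * ‖(toLp 2 (B *ᵥ a) : EuclideanSpace 𝕜 m)‖ ∧
      ‖(toLp 2 b : EuclideanSpace 𝕜 m)‖ ≤
        β₂⁻¹ * (1 + η / γ) * ‖(toLp 2 (H *ᵥ a + C *ᵥ b) : EuclideanSpace 𝕜 n)‖ +
          β₂⁻¹ * β₁⁻¹ * η * (1 + η / γ) * ‖(toLp 2 (B *ᵥ a) : EuclideanSpace 𝕜 m)‖ := by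
  have hB' : ∀ x ∈ (LinearMap.ker (toEuclideanLin B))ᗮ, β₁ * ‖x‖ ≤ ‖toEuclideanLin B x‖ :=
    fun x hx => norm_le_of_mem_ker_orthogonal (toEuclideanLin B)
      (fun q => by rw [← Matrix.toEuclideanLin_conjTranspose_eq_adjoint]; exact hB q) hx
  have hHC' : ∀ w ∈ LinearMap.ker (toEuclideanLin B), ∃ z : EuclideanSpace 𝕜 n,
      (∀ q : EuclideanSpace 𝕜 m, ⟪z, toEuclideanLin C q⟫_𝕜 = 0) ∧ ‖z‖ ≤ ‖w‖ ∧
        γ * ‖w‖ ^ 2 ≤ re ⟪z, toEuclideanLin H w⟫_𝕜 := by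
    intro w hw
    obtain ⟨z, hz, hzw, hzH⟩ := hHC w (LinearMap.mem_ker.mp hw)
    refine ⟨z, fun q => ?_, hzw, hzH⟩
    rw [← LinearMap.adjoint_inner_left, ← Matrix.toEuclideanLin_conjTranspose_eq_adjoint, hz, inner_zero_left]
  have key := apriori hγ hβ₁ hβ₂ hη hB' hC hHC' hH (toLp 2 a) (toLp 2 b)
  have e1 : toEuclideanLin H (toLp 2 a) + toEuclideanLin C (toLp 2 b) =
      (toLp 2 (H *ᵥ a + C *ᵥ b) : EuclideanSpace 𝕜 n) := by
    rw [Matrix.toLpLin_toLp, Matrix.toLpLin_toLp, ← WithLp.toLp_add]; rfl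
  have e2 : toEuclideanLin B (toLp 2 a) = (toLp 2 (B *ᵥ a) : EuclideanSpace 𝕜 m) := by
    rw [Matrix.toLpLin_toLp]; rfl
  rw [e1, e2] at key
  exact key

/-- [folklore] **Invertibility** of `fromBlocks H C B 0` under the hypotheses of `matrix_apriori`. -/
theorem isUnit_fromBlocks {H : Matrix n n 𝕜} {B : Matrix m n 𝕜} {C : Matrix n m 𝕜} {γ β₁ β₂ η : ℝ}
    (hγ : 0 < γ) (hβ₁ : 0 < β₁) (hβ₂ : 0 < β₂) (hη : 0 ≤ η)
    (hB : ∀ q : EuclideanSpace 𝕜 m, β₁ * ‖q‖ ≤ ‖toEuclideanLin Bᴴ q‖)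
    (hC : ∀ q : EuclideanSpace 𝕜 m, β₂ * ‖q‖ ≤ ‖toEuclideanLin C q‖)
    (hHC : ∀ w : EuclideanSpace 𝕜 n, toEuclideanLin B w = 0 → ∃ z : EuclideanSpace 𝕜 n,
      toEuclideanLin Cᴴ z = 0 ∧ ‖z‖ ≤ ‖w‖ ∧ γ * ‖w‖ ^ 2 ≤ re ⟪z, toEuclideanLin H w⟫_𝕜)
    (hH : ∀ v : EuclideanSpace 𝕜 n, ‖toEuclideanLin H v‖ ≤ η * ‖v‖) :
    IsUnit (Matrix.fromBlocks H C B 0) := by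
  rw [← Matrix.mulVec_injective_iff_isUnit]
  intro v v' hvv'
  rw [← sub_eq_zero]
  set d := v - v' with hd
  have hKd : Matrix.fromBlocks H C B 0 *ᵥ d = 0 := by rw [hd, Matrix.mulVec_sub, hvv', sub_self]
  have hsplit : Sum.elim (H *ᵥ (d ∘ Sum.inl) + C *ᵥ (d ∘ Sum.inr)) (B *ᵥ (d ∘ Sum.inl)) = 0 := by
    rw [← fromBlocks_mulVec_sumElim, Sum.elim_comp_inl_inr, hKd]
  have h1 : H *ᵥ (d ∘ Sum.inl) + C *ᵥ (d ∘ Sum.inr) = 0 := by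
    have := congr_arg (fun f => f ∘ Sum.inl) hsplit; simpa using this
  have h2 : B *ᵥ (d ∘ Sum.inl) = 0 := by
    have := congr_arg (fun f => f ∘ Sum.inr) hsplit; simpa using this
  obtain ⟨ea, eb⟩ := matrix_apriori hγ hβ₁ hβ₂ hη hB hC hHC hH (d ∘ Sum.inl) (d ∘ Sum.inr)
  rw [h1, h2] at ea eb
  have ha : d ∘ Sum.inl = 0 := by simpa using ea
  have hb : d ∘ Sum.inr = 0 := by simpa using eb
  rw [← Sum.elim_comp_inl_inr d, ha, hb]
  funext i; cases i <;> rfl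

omit [Fintype m] [DecidableEq m] in
/-- [folklore] Classical case `C = Bᴴ`: coercivity of `re ⟪w, H w⟫` on `ker B` supplies the kernel test vector `z = w`. -/
theorem matrix_test_vector_of_coercive {H : Matrix n n 𝕜} {B : Matrix m n 𝕜} {γ : ℝ}
    (hcoer : ∀ w : EuclideanSpace 𝕜 n, toEuclideanLin B w = 0 → γ * ‖w‖ ^ 2 ≤ re ⟪w, toEuclideanLin H w⟫_𝕜) :
    ∀ w : EuclideanSpace 𝕜 n, toEuclideanLin B w = 0 → ∃ z : EuclideanSpace 𝕜 n,
      toEuclideanLin Bᴴᴴ z = 0 ∧ ‖z‖ ≤ ‖w‖ ∧ γ * ‖w‖ ^ 2 ≤ re ⟪z, toEuclideanLin H w⟫_𝕜 :=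
  fun w hw => ⟨w, by rwa [Matrix.conjTranspose_conjTranspose], le_rfl, hcoer w hw⟩

/-- [folklore] **Brezzi's a priori estimate, matrix form** (`K = fromBlocks H Bᴴ B 0`; the statement of the table row P1-L10a): LBB
`β‖q‖ ≤ ‖Bᴴ q‖`, coercivity `γ‖w‖² ≤ re ⟪w, H w⟫` on `ker B`, `‖H‖ ≤ η` ⟹ the two Brezzi bounds for every `(a, b)`. -/
theorem matrix_apriori_conjTranspose {H : Matrix n n 𝕜} {B : Matrix m n 𝕜} {γ β η : ℝ}
    (hγ : 0 < γ) (hβ : 0 < β) (hη : 0 ≤ η)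
    (hB : ∀ q : EuclideanSpace 𝕜 m, β * ‖q‖ ≤ ‖toEuclideanLin Bᴴ q‖)
    (hcoer : ∀ w : EuclideanSpace 𝕜 n, toEuclideanLin B w = 0 → γ * ‖w‖ ^ 2 ≤ re ⟪w, toEuclideanLin H w⟫_𝕜)
    (hH : ∀ v : EuclideanSpace 𝕜 n, ‖toEuclideanLin H v‖ ≤ η * ‖v‖) (a : n → 𝕜) (b : m → 𝕜) :
    ‖(toLp 2 a : EuclideanSpace 𝕜 n)‖ ≤ γ⁻¹ * ‖(toLp 2 (H *ᵥ a + Bᴴ *ᵥ b) : EuclideanSpace 𝕜 n)‖ +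
        β⁻¹ * (1 + η / γ) * ‖(toLp 2 (B *ᵥ a) : EuclideanSpace 𝕜 m)‖ ∧
      ‖(toLp 2 b : EuclideanSpace 𝕜 m)‖ ≤
        β⁻¹ * (1 + η / γ) * ‖(toLp 2 (H *ᵥ a + Bᴴ *ᵥ b) : EuclideanSpace 𝕜 n)‖ +
          β⁻¹ * β⁻¹ * η * (1 + η / γ) * ‖(toLp 2 (B *ᵥ a) : EuclideanSpace 𝕜 m)‖ :=
  matrix_apriori hγ hβ hβ hη hB hB (matrix_test_vector_of_coercive hcoer) hH a b

/-- [folklore] **Brezzi's splitting theorem, matrix form**: under the hypotheses of `matrix_apriori_conjTranspose` the saddle-point matrix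
`fromBlocks H Bᴴ B 0` is invertible. -/
theorem isUnit_fromBlocks_conjTranspose {H : Matrix n n 𝕜} {B : Matrix m n 𝕜} {γ β η : ℝ}
    (hγ : 0 < γ) (hβ : 0 < β) (hη : 0 ≤ η)
    (hB : ∀ q : EuclideanSpace 𝕜 m, β * ‖q‖ ≤ ‖toEuclideanLin Bᴴ q‖)
    (hcoer : ∀ w : EuclideanSpace 𝕜 n, toEuclideanLin B w = 0 → γ * ‖w‖ ^ 2 ≤ re ⟪w, toEuclideanLin H w⟫_𝕜)
    (hH : ∀ v : EuclideanSpace 𝕜 n, ‖toEuclideanLin H v‖ ≤ η * ‖v‖) :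
    IsUnit (Matrix.fromBlocks H Bᴴ B 0) :=
  isUnit_fromBlocks hγ hβ hβ hη hB hB (matrix_test_vector_of_coercive hcoer) hH

end MatrixForm

end Summit.QuantumFields.BalabanUV.Beta.GAN24.SaddlePointBound
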